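import Summits.HodgeConjecture.HodgeConjecture.Theorems.Ring2WeilCoverageNormClassEq
import HarnessLib

/-!
# Ring 2 · Weil-type family-coverage census (ring2-b04, gen 40) — SAME-COMPONENT certificates, part D2 (`d = 2, 7, 11`)

research route conditional on HC_CM; not a corollary; Q11.4-sentence-2 already refuted in dim ≥ 3.
`HC_CM` (`Theses.RankFourFaces.CMAbelianHodge`, by name) does not occur in this file; no case of the Hodge
conjecture is claimed. Cell `pub-hodge-ring2`, seat `ring2-b04` (gen 40); continuation of `Ring2WeilCoverageNormClassEq`
(§0 there: `mk_eq_mk_of_mul_mem`, `mk_neg_eq_mk_neg_iff`; the fields `d = 3, 1` in both letters). Here: for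
`K = ℚ(√-d)`, `d ∈ {2, 7, 11}`, every squarefree NON-norm `a ≤ 60` is identified with the least representative `a₀`
of its class in `ℚˣ/Nm(K_dˣ)` — `SqrtNeg{d}.class_{a}_eq_{a₀} : [a] = [a₀]` by one explicit `a·a₀ = x² + d y²`
(rows `W6.d.a₀` / `W4.d.a₀` of `WEIL-FAMILY-COVERAGE.md`, column «other squarefree a ≤ 60 in the class»); the
sixfold/tenfold letter `[-a] = [-a₀]` is `(mk_neg_eq_mk_neg_iff _ _).2 (class_{a}_eq_{a₀})`. Sorry-free; axioms
standard; no `def`, no named fact.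

## References

* [vanGeemen1994HodgeAV] B. van Geemen, LNM 1594 (1994), 4.14, Lemma 5.2 (3), (5.4.1).
* [Markman2025SecantWeil] E. Markman, arXiv:2502.03415 (preprint), §1.1.
-/

noncomputable section

set_option linter.dupNamespace false

open Literature.AlgebraicGeometry.Motives
open Literature.AlgebraicGeometry.VanGeemen1994
open Summit.HodgeConjecture.HodgeConjecture.Ring2.Hypotheses

namespace Summit.HodgeConjecture.HodgeConjecture.Ring2.WeilCoverage

/-! ### §1 `K = ℚ(√-2)`: squarefree non-norms `a ≤ 60` identified with the least representative of their class -/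

namespace SqrtNeg2

/-- `[10] = [5]` in `ℚˣ/Nm(ℚ(√-2)ˣ)` (`T = {2, 5}`): `10·5 = 50 = 0² + 2·5²`. research route conditional on HC_CM; not a corollary; Q11.4-sentence-2 already refuted in dim ≥ 3. [cite: vanGeemen1994HodgeAV, Lemma 5.2 (3)] -/
theorem class_10_eq_5 :
    (QuotientGroup.mk (Units.mk0 (10 : ℚ) (by norm_num)) : weilNormResidueGroup 2) =
      QuotientGroup.mk (Units.mk0 (5 : ℚ) (by norm_num)) :=
  mk_eq_mk_of_mul_mem _ _ (mem_normUnitsSubgroup_of_sq_add_mul_sq _ 0 5 (by norm_num))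

/-- `[15] = [5]` in `ℚˣ/Nm(ℚ(√-2)ˣ)` (`T = {2, 5}`): `15·5 = 75 = 5² + 2·5²`. research route conditional on HC_CM; not a corollary; Q11.4-sentence-2 already refuted in dim ≥ 3. [cite: vanGeemen1994HodgeAV, Lemma 5.2 (3)] -/
theorem class_15_eq_5 :
    (QuotientGroup.mk (Units.mk0 (15 : ℚ) (by norm_num)) : weilNormResidueGroup 2) =
      QuotientGroup.mk (Units.mk0 (5 : ℚ) (by norm_num)) :=
  mk_eq_mk_of_mul_mem _ _ (mem_normUnitsSubgroup_of_sq_add_mul_sq _ 5 5 (by norm_num))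

/-- `[30] = [5]` in `ℚˣ/Nm(ℚ(√-2)ˣ)` (`T = {2, 5}`): `30·5 = 150 = 10² + 2·5²`. research route conditional on HC_CM; not a corollary; Q11.4-sentence-2 already refuted in dim ≥ 3. [cite: vanGeemen1994HodgeAV, Lemma 5.2 (3)] -/
theorem class_30_eq_5 :
    (QuotientGroup.mk (Units.mk0 (30 : ℚ) (by norm_num)) : weilNormResidueGroup 2) =
      QuotientGroup.mk (Units.mk0 (5 : ℚ) (by norm_num)) :=
  mk_eq_mk_of_mul_mem _ _ (mem_normUnitsSubgroup_of_sq_add_mul_sq _ 10 5 (by norm_num))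

/-- `[55] = [5]` in `ℚˣ/Nm(ℚ(√-2)ˣ)` (`T = {2, 5}`): `55·5 = 275 = 15² + 2·5²`. research route conditional on HC_CM; not a corollary; Q11.4-sentence-2 already refuted in dim ≥ 3. [cite: vanGeemen1994HodgeAV, Lemma 5.2 (3)] -/
theorem class_55_eq_5 :
    (QuotientGroup.mk (Units.mk0 (55 : ℚ) (by norm_num)) : weilNormResidueGroup 2) =
      QuotientGroup.mk (Units.mk0 (5 : ℚ) (by norm_num)) :=
  mk_eq_mk_of_mul_mem _ _ (mem_normUnitsSubgroup_of_sq_add_mul_sq _ 15 5 (by norm_num))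

/-- `[14] = [7]` in `ℚˣ/Nm(ℚ(√-2)ˣ)` (`T = {2, 7}`): `14·7 = 98 = 0² + 2·7²`. research route conditional on HC_CM; not a corollary; Q11.4-sentence-2 already refuted in dim ≥ 3. [cite: vanGeemen1994HodgeAV, Lemma 5.2 (3)] -/
theorem class_14_eq_7 :
    (QuotientGroup.mk (Units.mk0 (14 : ℚ) (by norm_num)) : weilNormResidueGroup 2) =
      QuotientGroup.mk (Units.mk0 (7 : ℚ) (by norm_num)) :=
  mk_eq_mk_of_mul_mem _ _ (mem_normUnitsSubgroup_of_sq_add_mul_sq _ 0 7 (by norm_num))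

/-- `[21] = [7]` in `ℚˣ/Nm(ℚ(√-2)ˣ)` (`T = {2, 7}`): `21·7 = 147 = 7² + 2·7²`. research route conditional on HC_CM; not a corollary; Q11.4-sentence-2 already refuted in dim ≥ 3. [cite: vanGeemen1994HodgeAV, Lemma 5.2 (3)] -/
theorem class_21_eq_7 :
    (QuotientGroup.mk (Units.mk0 (21 : ℚ) (by norm_num)) : weilNormResidueGroup 2) =
      QuotientGroup.mk (Units.mk0 (7 : ℚ) (by norm_num)) :=
  mk_eq_mk_of_mul_mem _ _ (mem_normUnitsSubgroup_of_sq_add_mul_sq _ 7 7 (by norm_num))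

/-- `[42] = [7]` in `ℚˣ/Nm(ℚ(√-2)ˣ)` (`T = {2, 7}`): `42·7 = 294 = 14² + 2·7²`. research route conditional on HC_CM; not a corollary; Q11.4-sentence-2 already refuted in dim ≥ 3. [cite: vanGeemen1994HodgeAV, Lemma 5.2 (3)] -/
theorem class_42_eq_7 :
    (QuotientGroup.mk (Units.mk0 (42 : ℚ) (by norm_num)) : weilNormResidueGroup 2) =
      QuotientGroup.mk (Units.mk0 (7 : ℚ) (by norm_num)) :=
  mk_eq_mk_of_mul_mem _ _ (mem_normUnitsSubgroup_of_sq_add_mul_sq _ 14 7 (by norm_num))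

/-- `[26] = [13]` in `ℚˣ/Nm(ℚ(√-2)ˣ)` (`T = {2, 13}`): `26·13 = 338 = 0² + 2·13²`. research route conditional on HC_CM; not a corollary; Q11.4-sentence-2 already refuted in dim ≥ 3. [cite: vanGeemen1994HodgeAV, Lemma 5.2 (3)] -/
theorem class_26_eq_13 :
    (QuotientGroup.mk (Units.mk0 (26 : ℚ) (by norm_num)) : weilNormResidueGroup 2) =
      QuotientGroup.mk (Units.mk0 (13 : ℚ) (by norm_num)) :=
  mk_eq_mk_of_mul_mem _ _ (mem_normUnitsSubgroup_of_sq_add_mul_sq _ 0 13 (by norm_num))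

/-- `[39] = [13]` in `ℚˣ/Nm(ℚ(√-2)ˣ)` (`T = {2, 13}`): `39·13 = 507 = 13² + 2·13²`. research route conditional on HC_CM; not a corollary; Q11.4-sentence-2 already refuted in dim ≥ 3. [cite: vanGeemen1994HodgeAV, Lemma 5.2 (3)] -/
theorem class_39_eq_13 :
    (QuotientGroup.mk (Units.mk0 (39 : ℚ) (by norm_num)) : weilNormResidueGroup 2) =
      QuotientGroup.mk (Units.mk0 (13 : ℚ) (by norm_num)) :=
  mk_eq_mk_of_mul_mem _ _ (mem_normUnitsSubgroup_of_sq_add_mul_sq _ 13 13 (by norm_num))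

/-- `[46] = [23]` in `ℚˣ/Nm(ℚ(√-2)ˣ)` (`T = {2, 23}`): `46·23 = 1058 = 0² + 2·23²`. research route conditional on HC_CM; not a corollary; Q11.4-sentence-2 already refuted in dim ≥ 3. [cite: vanGeemen1994HodgeAV, Lemma 5.2 (3)] -/
theorem class_46_eq_23 :
    (QuotientGroup.mk (Units.mk0 (46 : ℚ) (by norm_num)) : weilNormResidueGroup 2) =
      QuotientGroup.mk (Units.mk0 (23 : ℚ) (by norm_num)) :=
  mk_eq_mk_of_mul_mem _ _ (mem_normUnitsSubgroup_of_sq_add_mul_sq _ 0 23 (by norm_num))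

/-- `[58] = [29]` in `ℚˣ/Nm(ℚ(√-2)ˣ)` (`T = {2, 29}`): `58·29 = 1682 = 0² + 2·29²`. research route conditional on HC_CM; not a corollary; Q11.4-sentence-2 already refuted in dim ≥ 3. [cite: vanGeemen1994HodgeAV, Lemma 5.2 (3)] -/
theorem class_58_eq_29 :
    (QuotientGroup.mk (Units.mk0 (58 : ℚ) (by norm_num)) : weilNormResidueGroup 2) =
      QuotientGroup.mk (Units.mk0 (29 : ℚ) (by norm_num)) :=
  mk_eq_mk_of_mul_mem _ _ (mem_normUnitsSubgroup_of_sq_add_mul_sq _ 0 29 (by norm_num))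

end SqrtNeg2

/-! ### §2 `K = ℚ(√-7)`: squarefree non-norms `a ≤ 60` identified with the least representative of their class -/

namespace SqrtNeg7

/-- `[6] = [3]` in `ℚˣ/Nm(ℚ(√-7)ˣ)` (`T = {3, 7}`): `6·3 = 18 = 3/2² + 7·3/2²`. research route conditional on HC_CM; not a corollary; Q11.4-sentence-2 already refuted in dim ≥ 3. [cite: vanGeemen1994HodgeAV, Lemma 5.2 (3)] -/
theorem class_6_eq_3 :
    (QuotientGroup.mk (Units.mk0 (6 : ℚ) (by norm_num)) : weilNormResidueGroup 7) =
      QuotientGroup.mk (Units.mk0 (3 : ℚ) (by norm_num)) :=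
  mk_eq_mk_of_mul_mem _ _ (mem_normUnitsSubgroup_of_sq_add_mul_sq _ (3 / 2 : ℚ) (3 / 2 : ℚ) (by norm_num))

/-- `[21] = [3]` in `ℚˣ/Nm(ℚ(√-7)ˣ)` (`T = {3, 7}`): `21·3 = 63 = 0² + 7·3²`. research route conditional on HC_CM; not a corollary; Q11.4-sentence-2 already refuted in dim ≥ 3. [cite: vanGeemen1994HodgeAV, Lemma 5.2 (3)] -/
theorem class_21_eq_3 :
    (QuotientGroup.mk (Units.mk0 (21 : ℚ) (by norm_num)) : weilNormResidueGroup 7) =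
      QuotientGroup.mk (Units.mk0 (3 : ℚ) (by norm_num)) :=
  mk_eq_mk_of_mul_mem _ _ (mem_normUnitsSubgroup_of_sq_add_mul_sq _ 0 3 (by norm_num))

/-- `[33] = [3]` in `ℚˣ/Nm(ℚ(√-7)ˣ)` (`T = {3, 7}`): `33·3 = 99 = 6² + 7·3²`. research route conditional on HC_CM; not a corollary; Q11.4-sentence-2 already refuted in dim ≥ 3. [cite: vanGeemen1994HodgeAV, Lemma 5.2 (3)] -/
theorem class_33_eq_3 :
    (QuotientGroup.mk (Units.mk0 (33 : ℚ) (by norm_num)) : weilNormResidueGroup 7) =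
      QuotientGroup.mk (Units.mk0 (3 : ℚ) (by norm_num)) :=
  mk_eq_mk_of_mul_mem _ _ (mem_normUnitsSubgroup_of_sq_add_mul_sq _ 6 3 (by norm_num))

/-- `[42] = [3]` in `ℚˣ/Nm(ℚ(√-7)ˣ)` (`T = {3, 7}`): `42·3 = 126 = 21/2² + 7·3/2²`. research route conditional on HC_CM; not a corollary; Q11.4-sentence-2 already refuted in dim ≥ 3. [cite: vanGeemen1994HodgeAV, Lemma 5.2 (3)] -/
theorem class_42_eq_3 :
    (QuotientGroup.mk (Units.mk0 (42 : ℚ) (by norm_num)) : weilNormResidueGroup 7) =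
      QuotientGroup.mk (Units.mk0 (3 : ℚ) (by norm_num)) :=
  mk_eq_mk_of_mul_mem _ _ (mem_normUnitsSubgroup_of_sq_add_mul_sq _ (21 / 2 : ℚ) (3 / 2 : ℚ) (by norm_num))

/-- `[10] = [5]` in `ℚˣ/Nm(ℚ(√-7)ˣ)` (`T = {5, 7}`): `10·5 = 50 = 5/2² + 7·5/2²`. research route conditional on HC_CM; not a corollary; Q11.4-sentence-2 already refuted in dim ≥ 3. [cite: vanGeemen1994HodgeAV, Lemma 5.2 (3)] -/
theorem class_10_eq_5 :
    (QuotientGroup.mk (Units.mk0 (10 : ℚ) (by norm_num)) : weilNormResidueGroup 7) =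
      QuotientGroup.mk (Units.mk0 (5 : ℚ) (by norm_num)) :=
  mk_eq_mk_of_mul_mem _ _ (mem_normUnitsSubgroup_of_sq_add_mul_sq _ (5 / 2 : ℚ) (5 / 2 : ℚ) (by norm_num))

/-- `[35] = [5]` in `ℚˣ/Nm(ℚ(√-7)ˣ)` (`T = {5, 7}`): `35·5 = 175 = 0² + 7·5²`. research route conditional on HC_CM; not a corollary; Q11.4-sentence-2 already refuted in dim ≥ 3. [cite: vanGeemen1994HodgeAV, Lemma 5.2 (3)] -/
theorem class_35_eq_5 :
    (QuotientGroup.mk (Units.mk0 (35 : ℚ) (by norm_num)) : weilNormResidueGroup 7) =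
      QuotientGroup.mk (Units.mk0 (5 : ℚ) (by norm_num)) :=
  mk_eq_mk_of_mul_mem _ _ (mem_normUnitsSubgroup_of_sq_add_mul_sq _ 0 5 (by norm_num))

/-- `[55] = [5]` in `ℚˣ/Nm(ℚ(√-7)ˣ)` (`T = {5, 7}`): `55·5 = 275 = 10² + 7·5²`. research route conditional on HC_CM; not a corollary; Q11.4-sentence-2 already refuted in dim ≥ 3. [cite: vanGeemen1994HodgeAV, Lemma 5.2 (3)] -/
theorem class_55_eq_5 :
    (QuotientGroup.mk (Units.mk0 (55 : ℚ) (by norm_num)) : weilNormResidueGroup 7) =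
      QuotientGroup.mk (Units.mk0 (5 : ℚ) (by norm_num)) :=
  mk_eq_mk_of_mul_mem _ _ (mem_normUnitsSubgroup_of_sq_add_mul_sq _ 10 5 (by norm_num))

/-- `[26] = [13]` in `ℚˣ/Nm(ℚ(√-7)ˣ)` (`T = {7, 13}`): `26·13 = 338 = 13/2² + 7·13/2²`. research route conditional on HC_CM; not a corollary; Q11.4-sentence-2 already refuted in dim ≥ 3. [cite: vanGeemen1994HodgeAV, Lemma 5.2 (3)] -/
theorem class_26_eq_13 :
    (QuotientGroup.mk (Units.mk0 (26 : ℚ) (by norm_num)) : weilNormResidueGroup 7) =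
      QuotientGroup.mk (Units.mk0 (13 : ℚ) (by norm_num)) :=
  mk_eq_mk_of_mul_mem _ _ (mem_normUnitsSubgroup_of_sq_add_mul_sq _ (13 / 2 : ℚ) (13 / 2 : ℚ) (by norm_num))

/-- `[30] = [15]` in `ℚˣ/Nm(ℚ(√-7)ˣ)` (`T = {3, 5}`): `30·15 = 450 = 15/2² + 7·15/2²`. research route conditional on HC_CM; not a corollary; Q11.4-sentence-2 already refuted in dim ≥ 3. [cite: vanGeemen1994HodgeAV, Lemma 5.2 (3)] -/
theorem class_30_eq_15 :
    (QuotientGroup.mk (Units.mk0 (30 : ℚ) (by norm_num)) : weilNormResidueGroup 7) =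
      QuotientGroup.mk (Units.mk0 (15 : ℚ) (by norm_num)) :=
  mk_eq_mk_of_mul_mem _ _ (mem_normUnitsSubgroup_of_sq_add_mul_sq _ (15 / 2 : ℚ) (15 / 2 : ℚ) (by norm_num))

/-- `[34] = [17]` in `ℚˣ/Nm(ℚ(√-7)ˣ)` (`T = {7, 17}`): `34·17 = 578 = 17/2² + 7·17/2²`. research route conditional on HC_CM; not a corollary; Q11.4-sentence-2 already refuted in dim ≥ 3. [cite: vanGeemen1994HodgeAV, Lemma 5.2 (3)] -/
theorem class_34_eq_17 :
    (QuotientGroup.mk (Units.mk0 (34 : ℚ) (by norm_num)) : weilNormResidueGroup 7) =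
      QuotientGroup.mk (Units.mk0 (17 : ℚ) (by norm_num)) :=
  mk_eq_mk_of_mul_mem _ _ (mem_normUnitsSubgroup_of_sq_add_mul_sq _ (17 / 2 : ℚ) (17 / 2 : ℚ) (by norm_num))

/-- `[38] = [19]` in `ℚˣ/Nm(ℚ(√-7)ˣ)` (`T = {7, 19}`): `38·19 = 722 = 19/2² + 7·19/2²`. research route conditional on HC_CM; not a corollary; Q11.4-sentence-2 already refuted in dim ≥ 3. [cite: vanGeemen1994HodgeAV, Lemma 5.2 (3)] -/
theorem class_38_eq_19 :
    (QuotientGroup.mk (Units.mk0 (38 : ℚ) (by norm_num)) : weilNormResidueGroup 7) =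
      QuotientGroup.mk (Units.mk0 (19 : ℚ) (by norm_num)) :=
  mk_eq_mk_of_mul_mem _ _ (mem_normUnitsSubgroup_of_sq_add_mul_sq _ (19 / 2 : ℚ) (19 / 2 : ℚ) (by norm_num))

end SqrtNeg7

/-! ### §3 `K = ℚ(√-11)`: squarefree non-norms `a ≤ 60` identified with the least representative of their class -/

namespace SqrtNeg11

/-- `[6] = [2]` in `ℚˣ/Nm(ℚ(√-11)ˣ)` (`T = {2, 11}`): `6·2 = 12 = 1² + 11·1²`. research route conditional on HC_CM; not a corollary; Q11.4-sentence-2 already refuted in dim ≥ 3. [cite: vanGeemen1994HodgeAV, Lemma 5.2 (3)] -/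
theorem class_6_eq_2 :
    (QuotientGroup.mk (Units.mk0 (6 : ℚ) (by norm_num)) : weilNormResidueGroup 11) =
      QuotientGroup.mk (Units.mk0 (2 : ℚ) (by norm_num)) :=
  mk_eq_mk_of_mul_mem _ _ (mem_normUnitsSubgroup_of_sq_add_mul_sq _ 1 1 (by norm_num))

/-- `[10] = [2]` in `ℚˣ/Nm(ℚ(√-11)ˣ)` (`T = {2, 11}`): `10·2 = 20 = 3² + 11·1²`. research route conditional on HC_CM; not a corollary; Q11.4-sentence-2 already refuted in dim ≥ 3. [cite: vanGeemen1994HodgeAV, Lemma 5.2 (3)] -/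
theorem class_10_eq_2 :
    (QuotientGroup.mk (Units.mk0 (10 : ℚ) (by norm_num)) : weilNormResidueGroup 11) =
      QuotientGroup.mk (Units.mk0 (2 : ℚ) (by norm_num)) :=
  mk_eq_mk_of_mul_mem _ _ (mem_normUnitsSubgroup_of_sq_add_mul_sq _ 3 1 (by norm_num))

/-- `[22] = [2]` in `ℚˣ/Nm(ℚ(√-11)ˣ)` (`T = {2, 11}`): `22·2 = 44 = 0² + 11·2²`. research route conditional on HC_CM; not a corollary; Q11.4-sentence-2 already refuted in dim ≥ 3. [cite: vanGeemen1994HodgeAV, Lemma 5.2 (3)] -/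
theorem class_22_eq_2 :
    (QuotientGroup.mk (Units.mk0 (22 : ℚ) (by norm_num)) : weilNormResidueGroup 11) =
      QuotientGroup.mk (Units.mk0 (2 : ℚ) (by norm_num)) :=
  mk_eq_mk_of_mul_mem _ _ (mem_normUnitsSubgroup_of_sq_add_mul_sq _ 0 2 (by norm_num))

/-- `[30] = [2]` in `ℚˣ/Nm(ℚ(√-11)ˣ)` (`T = {2, 11}`): `30·2 = 60 = 7² + 11·1²`. research route conditional on HC_CM; not a corollary; Q11.4-sentence-2 already refuted in dim ≥ 3. [cite: vanGeemen1994HodgeAV, Lemma 5.2 (3)] -/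
theorem class_30_eq_2 :
    (QuotientGroup.mk (Units.mk0 (30 : ℚ) (by norm_num)) : weilNormResidueGroup 11) =
      QuotientGroup.mk (Units.mk0 (2 : ℚ) (by norm_num)) :=
  mk_eq_mk_of_mul_mem _ _ (mem_normUnitsSubgroup_of_sq_add_mul_sq _ 7 1 (by norm_num))

/-- `[46] = [2]` in `ℚˣ/Nm(ℚ(√-11)ˣ)` (`T = {2, 11}`): `46·2 = 92 = 9² + 11·1²`. research route conditional on HC_CM; not a corollary; Q11.4-sentence-2 already refuted in dim ≥ 3. [cite: vanGeemen1994HodgeAV, Lemma 5.2 (3)] -/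
theorem class_46_eq_2 :
    (QuotientGroup.mk (Units.mk0 (46 : ℚ) (by norm_num)) : weilNormResidueGroup 11) =
      QuotientGroup.mk (Units.mk0 (2 : ℚ) (by norm_num)) :=
  mk_eq_mk_of_mul_mem _ _ (mem_normUnitsSubgroup_of_sq_add_mul_sq _ 9 1 (by norm_num))

/-- `[21] = [7]` in `ℚˣ/Nm(ℚ(√-11)ˣ)` (`T = {7, 11}`): `21·7 = 147 = 7/2² + 11·7/2²`. research route conditional on HC_CM; not a corollary; Q11.4-sentence-2 already refuted in dim ≥ 3. [cite: vanGeemen1994HodgeAV, Lemma 5.2 (3)] -/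
theorem class_21_eq_7 :
    (QuotientGroup.mk (Units.mk0 (21 : ℚ) (by norm_num)) : weilNormResidueGroup 11) =
      QuotientGroup.mk (Units.mk0 (7 : ℚ) (by norm_num)) :=
  mk_eq_mk_of_mul_mem _ _ (mem_normUnitsSubgroup_of_sq_add_mul_sq _ (7 / 2 : ℚ) (7 / 2 : ℚ) (by norm_num))

/-- `[35] = [7]` in `ℚˣ/Nm(ℚ(√-11)ˣ)` (`T = {7, 11}`): `35·7 = 245 = 21/2² + 11·7/2²`. research route conditional on HC_CM; not a corollary; Q11.4-sentence-2 already refuted in dim ≥ 3. [cite: vanGeemen1994HodgeAV, Lemma 5.2 (3)] -/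
theorem class_35_eq_7 :
    (QuotientGroup.mk (Units.mk0 (35 : ℚ) (by norm_num)) : weilNormResidueGroup 11) =
      QuotientGroup.mk (Units.mk0 (7 : ℚ) (by norm_num)) :=
  mk_eq_mk_of_mul_mem _ _ (mem_normUnitsSubgroup_of_sq_add_mul_sq _ (21 / 2 : ℚ) (7 / 2 : ℚ) (by norm_num))

/-- `[39] = [13]` in `ℚˣ/Nm(ℚ(√-11)ˣ)` (`T = {11, 13}`): `39·13 = 507 = 13/2² + 11·13/2²`. research route conditional on HC_CM; not a corollary; Q11.4-sentence-2 already refuted in dim ≥ 3. [cite: vanGeemen1994HodgeAV, Lemma 5.2 (3)] -/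
theorem class_39_eq_13 :
    (QuotientGroup.mk (Units.mk0 (39 : ℚ) (by norm_num)) : weilNormResidueGroup 11) =
      QuotientGroup.mk (Units.mk0 (13 : ℚ) (by norm_num)) :=
  mk_eq_mk_of_mul_mem _ _ (mem_normUnitsSubgroup_of_sq_add_mul_sq _ (13 / 2 : ℚ) (13 / 2 : ℚ) (by norm_num))

/-- `[42] = [14]` in `ℚˣ/Nm(ℚ(√-11)ˣ)` (`T = {2, 7}`): `42·14 = 588 = 7² + 11·7²`. research route conditional on HC_CM; not a corollary; Q11.4-sentence-2 already refuted in dim ≥ 3. [cite: vanGeemen1994HodgeAV, Lemma 5.2 (3)] -/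
theorem class_42_eq_14 :
    (QuotientGroup.mk (Units.mk0 (42 : ℚ) (by norm_num)) : weilNormResidueGroup 11) =
      QuotientGroup.mk (Units.mk0 (14 : ℚ) (by norm_num)) :=
  mk_eq_mk_of_mul_mem _ _ (mem_normUnitsSubgroup_of_sq_add_mul_sq _ 7 7 (by norm_num))

/-- `[51] = [17]` in `ℚˣ/Nm(ℚ(√-11)ˣ)` (`T = {11, 17}`): `51·17 = 867 = 17/2² + 11·17/2²`. research route conditional on HC_CM; not a corollary; Q11.4-sentence-2 already refuted in dim ≥ 3. [cite: vanGeemen1994HodgeAV, Lemma 5.2 (3)] -/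
theorem class_51_eq_17 :
    (QuotientGroup.mk (Units.mk0 (51 : ℚ) (by norm_num)) : weilNormResidueGroup 11) =
      QuotientGroup.mk (Units.mk0 (17 : ℚ) (by norm_num)) :=
  mk_eq_mk_of_mul_mem _ _ (mem_normUnitsSubgroup_of_sq_add_mul_sq _ (17 / 2 : ℚ) (17 / 2 : ℚ) (by norm_num))

/-- `[57] = [19]` in `ℚˣ/Nm(ℚ(√-11)ˣ)` (`T = {11, 19}`): `57·19 = 1083 = 19/2² + 11·19/2²`. research route conditional on HC_CM; not a corollary; Q11.4-sentence-2 already refuted in dim ≥ 3. [cite: vanGeemen1994HodgeAV, Lemma 5.2 (3)] -/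
theorem class_57_eq_19 :
    (QuotientGroup.mk (Units.mk0 (57 : ℚ) (by norm_num)) : weilNormResidueGroup 11) =
      QuotientGroup.mk (Units.mk0 (19 : ℚ) (by norm_num)) :=
  mk_eq_mk_of_mul_mem _ _ (mem_normUnitsSubgroup_of_sq_add_mul_sq _ (19 / 2 : ℚ) (19 / 2 : ℚ) (by norm_num))

end SqrtNeg11

end Summit.HodgeConjecture.HodgeConjecture.Ring2.WeilCoverage

end
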